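import Summits.BirchSwinnertonDyer.Rank1Residual.SecondDescent.BSDpFromSecondDescentOneNonempty
import Literature.NumberTheory.EllipticCurves.SelmerGroupCardinality
import Literature.NumberTheory.EllipticCurves.BSDSelmerCMPConverseRankOneProofs
import Literature.NumberTheory.EllipticCurves.NonEisensteinPrimeOfSurjective
import HarnessLib

/-!
# The second-descent certificates read at SELMER level: the class of a Selmer element, the
# Mordell–Weil part of `Sel^(p)`, and the independence datum of a `NONEMPTY` record
# (cell `b2b-bsdres`, CLASS-CLOSURE instrument B-1 `SEL3CT-ALT`, seat cc-eng-4, GEN 15)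

HONEST FRAMING (cell `b2b-bsdres`, run/shared/lean/b2b/bsd-rank1-residual/, verbatim in every
file): the goal of the cell is to DELETE the COMBINATION-SHAPED residual classes of the
Birch–Swinnerton-Dyer formula for ALL analytic-rank `≤ 1` elliptic curves over `ℚ` — "full BSD
formula for every rank `≤ 1` curve in class `C`" assembled STRICTLY from published theorems — so
that the rank-`≤ 1` remainder becomes exactly the CONSTRUCTION-SHAPED classes, which are TYPED
(missing-input `Prop`s), NOT attempted. This is not "finishing BSD". Kernel TOOL theorems and
per-pair certificate SHAPES; NOT class theorems; no record filed; nothing booked (the lane books);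
the second-descent outputs behind any record are INSTRUMENTATION (E4) / EVIDENCE under
census-lead's tier label. THEOREMS ONLY (no definition, no named fact, no `sorry`).

## What this file does

Every `SecondDescent/*` consumer so far takes its second-`p`-descent certificate at the level of
`Ш = Ш(E/ℚ)`: classes `c₁ c₂ : W.sha` with `p • cᵢ = 0`, INDEPENDENCE `c₁ ≠ 0`, `c₂ ∉ ℤ∙c₁`, and
per class a verdict `NONEMPTY` (`p • dᵢ = cᵢ`) or `EMPTY` (`∀ d, p • d ≠ c`).  What the instrument
actually holds is one level up, in `Sel^(p)(E/ℚ) ⊆ H¹(ℚ, E[p])`: the front end's EXACT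
`𝔽_p`-basis `η₁, …, η_d` of `Sel^(p)` (the Theta frame of `octic_a3a.gp`), the Mordell–Weil classes
`δ(P)` located in that basis (`mwrule.py`), and one ternary cubic = one Selmer element per engine
verdict.  The passage `Sel^(p) → Ш[p]` is the PROVED fundamental exact sequence
`0 → E(K)/pE(K) → Sel^(p)(E/K) → Ш(E/K)[p] → 0` (Silverman *AEC* X.4.2; tree
`WeierstrassCurve.selmer_exact_holds`).  This file writes that passage out, so that a record's
EVIDENCE binders can be stated on the objects the engines certify:

* §1 (any number field `K`, any `n ≥ 1` / prime `p`):
  `exists_sha_coe_eq_torsionH1ToH1` — a Selmer element `ξ` HAS a class `c ∈ Ш`, `n • c = 0`, with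
  `↑c = (H¹(K,E[n]) → H¹(K,E)) ξ` (the linking hypothesis `hc` of every shape below is this
  bookkeeping identity); `natCard_selmerGroup_inf_ker` — the Mordell–Weil part
  `M := Sel^(n) ⊓ ker(H¹(K,E[n]) → H¹(K,E)) = κ(E(K))` has order `n ^ rank E(K) · #E(K)[n]`
  (Mordell–Weil, tree `module_finite_point_holds`); hence `M = ⊥` at rank `0` without rational
  `n`-torsion (`selmerGroup_inf_ker_eq_bot`) and `M = ℤ∙δ` for ANY non-zero `δ ∈ M` at rank `1`
  without rational `p`-torsion (`selmerGroup_inf_ker_eq_zmultiples`: a group of prime order is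
  generated by any non-zero element);
  `sha_ne_zero_and_not_mem_zmultiples_of_selmer` — the TRANSFER: `c₁ ≠ 0 ∧ c₂ ∉ ℤ∙c₁` in `Ш`
  iff-direction from "`a•ξ₁ + b•ξ₂ ∈ M ⇒ p ∣ a, p ∣ b`", specialised to `M = ⊥`
  (`…_of_inf_ker_eq_bot`: plain `𝔽_p`-independence of `ξ₁, ξ₂` — two DISTINCT members of the
  front's basis satisfy it by construction) and to `M ≤ ℤ∙δ` (`…_of_inf_ker_le_zmultiples`: JOINT
  independence of `ξ₁, ξ₂, δ`, i.e. `rank_𝔽ₚ {e₁, e₂, w} = 3` in the frame's coordinates).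
* §2 (`E/ℚ`, analytic rank `≤ 1`, GZK binder `hGZK`): `M = ⊥` at `r_an = 0`
  (`selmerGroup_inf_ker_eq_bot_of_analyticRank_eq_zero`), `M ≤ ℤ∙δ` at `r_an = 1`
  (`selmerGroup_inf_ker_le_zmultiples_of_analyticRank_eq_one`), and the class-free typed LOWER
  halves of `BSDpFromSecondDescentNonempty` / `…OneNonempty` RESTATED with Selmer-level binders:
  `missingLowerBoundAt_of_casselsTate_of_two_nonempty_selmer_rankZero`,
  `missingLowerBoundAt_of_casselsTate_of_one_nonempty_selmer_rankZero`,
  `missingLowerBoundAt_of_casselsTate_of_two_nonempty_selmer_mwLine`; one literal class shape as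
  the pattern, `X8.bsdp_three_rankZero_of_casselsTate_of_two_nonempty_selmer_of_surj` (= the
  `hcard`-free X8 consumer of GEN 11 fed through §1).

## What it says about the instrument (RUNBOOK, numbers not adjectives)

(a) `EMPTY` readings need NO independence / Mordell–Weil datum at any rank: "`c` not a `p`-th
multiple" already forces `c ≠ 0` (`0 = p • 0`).  (b) `NONEMPTY × 2` at `r_an = 0`, `E(ℚ)[p] = 0`
(every production row of record: 19215t1, the N4@3 canary 271726d1 / 405130d1 / 152330l1, the
X10a′ pair): the independence datum is "`η_i ≠ η_j` are two members of the EXACT frame" — nothing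
beyond the front's own certificate.  (c) `NONEMPTY × 2` at `r_an = 1`: the datum is the JOINT
condition `rank_𝔽₃ {e_i, e_j, w} = 3` (`w` = the located Mordell–Weil vector); the per-element
admissibility of `mwrule.py` v1.1 (`e_k ∉ 𝔽₃∙w`) does NOT imply it (`w = e_i ± e_j` passes both
per-element tests while `c_i = ∓ c_j` in `Ш[3]`) — finding F-MW-JOINT of `class-closure/eng-4/`
README ⟦GEN 15⟧; no row of record is affected (all `NONEMPTY × 2` records are rank `0`), and the
`NONEMPTY × 1 + partner` reading needs only `dim Sel₃ − dim W ≥ 2`.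

References: Silverman *AEC* X.4.2(a), VIII.§2 [SilvermanAEC2009]; Cremona 1997 §3.6 [Cremona1997];
Creutz 2014 §1 [Creutz2014]; Schaefer–Stoll 2004 §§5–6 (the `𝔽_p`-basis of `Sel^(p)` computed by
`p`-descent) [SchaeferStoll2004]; Miller 2011 Def. 1.1 [Miller2011LMS].
-/

noncomputable section

open scoped Classical

open WeierstrassCurve Literature.NumberTheory.EllipticCurves
open Literature.NumberTheory.EllipticCurves.Rank1Residual
open Literature.NumberTheory.EllipticCurves.Rank1Residual.Typed
open Literature.NumberTheory.EllipticCurves.Wuthrich2014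

namespace Summit.BirchSwinnertonDyer.Rank1Residual.SecondDescent

/-! ### §1 Any number field: the class of a Selmer element, the Mordell–Weil part of `Sel^(n)`,
and the transfer of independence from `Sel^(p)` to `Ш[p]` -/

section NumberField

variable {K : Type*} [Field K] [NumberField K] (W : WeierstrassCurve K)

/-- **The class of a Selmer element.** For `n ≥ 1` and `ξ ∈ Sel^(n)(E/K)`, the image of `ξ` under
`H¹(K,E[n]) → H¹(K,E)` lies in `Ш(E/K)` and is killed by `n`: there is `c : Ш` with `↑c` that image
and `n • c = 0` (surjectivity half of `0 → E(K)/nE(K) → Sel^(n) → Ш[n] → 0`, tree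
`selmer_exact_holds`). The identity `↑c = _` is the linking hypothesis `hc` of the shapes below.
[cite: SilvermanAEC2009, Thm X.4.2(a)] -/
theorem exists_sha_coe_eq_torsionH1ToH1 {n : ℕ} (hn : n ≠ 0) {ξ : W.galH1Torsion (n : ℤ)}
    (hξ : ξ ∈ W.selmerGroup (n : ℤ)) :
    ∃ c : W.sha, (c : W.galH1) = W.torsionH1ToH1 (n : ℤ) ξ ∧ n • c = 0 := by
  obtain ⟨κ, -, -, hmap⟩ := selmer_exact_holds W (n : ℤ) (by exact_mod_cast hn)
  have hmem : W.torsionH1ToH1 (n : ℤ) ξ ∈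
      (W.selmerGroup (n : ℤ)).map (W.torsionH1ToH1 (n : ℤ)) :=
    AddSubgroup.mem_map_of_mem _ hξ
  rw [hmap, AddSubgroup.mem_inf] at hmem
  refine ⟨⟨_, hmem.1⟩, rfl, ?_⟩
  apply Subtype.ext
  rw [AddSubgroupClass.coe_nsmul, ZeroMemClass.coe_zero]
  exact AddSubgroup.torsionBy.nsmul_iff.mp hmem.2

/-- **A class linked to a Selmer element is `n`-torsion**: if `↑c = (H¹(K,E[n]) → H¹(K,E)) ξ` with
`ξ ∈ Sel^(n)(E/K)`, `n ≥ 1`, then `n • c = 0` in `Ш(E/K)` (so the binders `h1 h2 : p • cᵢ = 0` of the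
`Ш`-level consumers are discharged by the linking identity). [cite: SilvermanAEC2009, Thm X.4.2(a)] -/
theorem nsmul_eq_zero_of_coe_eq_torsionH1ToH1 {n : ℕ} (hn : n ≠ 0) {ξ : W.galH1Torsion (n : ℤ)}
    (hξ : ξ ∈ W.selmerGroup (n : ℤ)) {c : W.sha}
    (hc : (c : W.galH1) = W.torsionH1ToH1 (n : ℤ) ξ) : n • c = 0 := by
  obtain ⟨c', hc', hn'⟩ := exists_sha_coe_eq_torsionH1ToH1 W hn hξ
  have hcc : c = c' := Subtype.ext (hc.trans hc'.symm)
  rw [hcc]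
  exact hn'

/-- **The Mordell–Weil part of the Selmer group has order `n ^ rank E(K) · #E(K)[n]`.** The subgroup
`Sel^(n)(E/K) ⊓ ker(H¹(K,E[n]) → H¹(K,E))` is the image `κ(E(K)) ≅ E(K)/nE(K)` of the Kummer map
(`selmer_exact_holds`), and `#(E(K)/nE(K)) = n ^ rank · #E(K)[n]` by the Mordell–Weil theorem
(tree `module_finite_point_holds`, `natCard_quotient_range_zsmul_eq_pow_mul_card_torsionBy`).
[cite: SilvermanAEC2009, Thm X.4.2(a) and VIII.6] [cite: Cremona1997, §3.6, p. 73] -/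
theorem natCard_selmerGroup_inf_ker [W.IsElliptic] (n : ℕ) [NeZero n] :
    Nat.card (W.selmerGroup (n : ℤ) ⊓ (W.torsionH1ToH1 (n : ℤ)).ker :
        AddSubgroup (W.galH1Torsion (n : ℤ))) =
      n ^ W.mordellWeilRank * Nat.card (AddSubgroup.torsionBy W.toAffine.Point n) := by
  obtain ⟨κ, hker, hrange, -⟩ := selmer_exact_holds W (n : ℤ) (by exact_mod_cast NeZero.ne n)
  haveI : Module.Finite ℤ W.toAffine.Point := W.module_finite_point_holds
  have e : Nat.card (W.selmerGroup (n : ℤ) ⊓ (W.torsionH1ToH1 (n : ℤ)).ker :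
        AddSubgroup (W.galH1Torsion (n : ℤ))) =
      Nat.card (W.toAffine.Point ⧸ (zsmulAddGroupHom (α := W.toAffine.Point) (n : ℤ)).range) := by
    rw [← hrange, ← hker]
    exact Nat.card_congr (QuotientAddGroup.quotientKerEquivRange κ).toEquiv.symm
  rw [e, natCard_quotient_range_zsmul_eq_pow_mul_card_torsionBy]
  rfl

/-- **Rank `0`, no rational `n`-torsion ⇒ the Mordell–Weil part of `Sel^(n)` is trivial**
(`#M = n^0 · 1 = 1`): then `Sel^(n)(E/K) → Ш(E/K)[n]` is injective. The situation of every
B-1 `NONEMPTY` production row of record (analytic rank `0`, `E(ℚ)[3] = 0`).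
[cite: SilvermanAEC2009, Thm X.4.2(a)] -/
theorem selmerGroup_inf_ker_eq_bot [W.IsElliptic] (n : ℕ) [NeZero n]
    (hrank : W.mordellWeilRank = 0)
    (htors : Nat.card (AddSubgroup.torsionBy W.toAffine.Point n) = 1) :
    W.selmerGroup (n : ℤ) ⊓ (W.torsionH1ToH1 (n : ℤ)).ker = ⊥ :=
  AddSubgroup.eq_bot_of_card_eq _
    (by rw [natCard_selmerGroup_inf_ker W n, hrank, htors, pow_zero, mul_one])

/-- **Rank `1`, no rational `p`-torsion ⇒ the Mordell–Weil part of `Sel^(p)` is the line through ANY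
of its non-zero elements** (`#M = p` is prime, so `M = ℤ∙δ` for every `δ ∈ M`, `δ ≠ 0`): the located
Mordell–Weil class `δ = κ(P)` (any `P ∉ pE(K)`) spans `M`, whichever generator the front found.
[cite: SilvermanAEC2009, Thm X.4.2(a) and VIII.6] -/
theorem selmerGroup_inf_ker_eq_zmultiples [W.IsElliptic] (p : ℕ) [hp : Fact p.Prime]
    (hrank : W.mordellWeilRank = 1)
    (htors : Nat.card (AddSubgroup.torsionBy W.toAffine.Point p) = 1)
    {δ : W.galH1Torsion (p : ℤ)} (hδ : δ ∈ W.selmerGroup (p : ℤ))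
    (hδker : W.torsionH1ToH1 (p : ℤ) δ = 0) (hδ0 : δ ≠ 0) :
    W.selmerGroup (p : ℤ) ⊓ (W.torsionH1ToH1 (p : ℤ)).ker = AddSubgroup.zmultiples δ := by
  haveI : NeZero p := ⟨hp.out.ne_zero⟩
  have hcardM : Nat.card (W.selmerGroup (p : ℤ) ⊓ (W.torsionH1ToH1 (p : ℤ)).ker :
      AddSubgroup (W.galH1Torsion (p : ℤ))) = p := by
    rw [natCard_selmerGroup_inf_ker W p, hrank, htors, pow_one, mul_one]
  haveI : Finite (W.selmerGroup (p : ℤ) ⊓ (W.torsionH1ToH1 (p : ℤ)).ker :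
      AddSubgroup (W.galH1Torsion (p : ℤ))) :=
    Nat.finite_of_card_ne_zero (by rw [hcardM]; exact hp.out.ne_zero)
  have hle : AddSubgroup.zmultiples δ ≤ W.selmerGroup (p : ℤ) ⊓ (W.torsionH1ToH1 (p : ℤ)).ker := by
    rw [AddSubgroup.zmultiples_le]
    exact ⟨hδ, (AddMonoidHom.mem_ker).mpr hδker⟩
  have hdvd : Nat.card (AddSubgroup.zmultiples δ) ∣ p := by
    have h := AddSubgroup.card_dvd_of_le hle
    rwa [hcardM] at h
  rcases (Nat.dvd_prime hp.out).mp hdvd with h1 | hp'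
  · exact absurd (AddSubgroup.zmultiples_eq_bot.mp (AddSubgroup.eq_bot_of_card_eq _ h1)) hδ0
  · exact (AddSubgroup.eq_of_le_of_card_ge hle (by rw [hcardM, hp'])).symm

/-- **Independence transfers from `Sel^(p)` to `Ш[p]`.** Let `ξ₁, ξ₂ ∈ H¹(K,E[p])` have images
`c₁, c₂ ∈ Ш(E/K)` (linking identities `hc₁ hc₂`). If every `ℤ`-combination `a•ξ₁ + b•ξ₂` that dies
in `H¹(K,E)` has `p ∣ a` and `p ∣ b`, then `c₁ ≠ 0` and `c₂ ∉ ℤ∙c₁` — exactly the binders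
`hc₁`/`hind` of the `NONEMPTY × 2` and `NONEMPTY × 1 + partner` consumers (`a = 1, b = 0` resp.
`a = -m, b = 1` would give `p ∣ 1`). [cite: SilvermanAEC2009, Thm X.4.2(a)] -/
theorem sha_ne_zero_and_not_mem_zmultiples_of_selmer (p : ℕ) [hp : Fact p.Prime]
    {ξ₁ ξ₂ : W.galH1Torsion (p : ℤ)} {c₁ c₂ : W.sha}
    (hc₁ : (c₁ : W.galH1) = W.torsionH1ToH1 (p : ℤ) ξ₁)
    (hc₂ : (c₂ : W.galH1) = W.torsionH1ToH1 (p : ℤ) ξ₂)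
    (hind : ∀ a b : ℤ, W.torsionH1ToH1 (p : ℤ) (a • ξ₁ + b • ξ₂) = 0 →
      (p : ℤ) ∣ a ∧ (p : ℤ) ∣ b) :
    c₁ ≠ 0 ∧ c₂ ∉ AddSubgroup.zmultiples c₁ := by
  have hp1 : ¬ (p : ℤ) ∣ 1 := by
    intro h
    have h1 : (p : ℤ) = 1 := Int.eq_one_of_dvd_one (Int.natCast_nonneg p) h
    exact hp.out.one_lt.ne' (by exact_mod_cast h1)
  constructor
  · intro h0
    apply hp1
    refine (hind 1 0 ?_).1
    rw [one_zsmul, zero_zsmul, add_zero, ← hc₁, h0, ZeroMemClass.coe_zero]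
  · intro hmem
    obtain ⟨m, hm⟩ := AddSubgroup.mem_zmultiples_iff.mp hmem
    apply hp1
    refine (hind (-m) 1 ?_).2
    have hm' : (c₂ : W.galH1) = m • (c₁ : W.galH1) := by
      rw [← hm, AddSubgroupClass.coe_zsmul]
    rw [map_add, map_zsmul, map_zsmul, one_zsmul, ← hc₁, ← hc₂, hm', neg_zsmul, neg_add_cancel]

/-- **Rank-`0` transfer (no Mordell–Weil datum).** If the Mordell–Weil part of `Sel^(p)` is trivial
(`selmerGroup_inf_ker_eq_bot`), two `𝔽_p`-INDEPENDENT Selmer elements `ξ₁, ξ₂` (`a•ξ₁ + b•ξ₂ = 0 ⇒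
p ∣ a, b`; two distinct members of a descent's `𝔽_p`-basis of `Sel^(p)`) have independent classes
`c₁ ≠ 0`, `c₂ ∉ ℤ∙c₁` in `Ш[p]`. [cite: SilvermanAEC2009, Thm X.4.2(a)] [cite: SchaeferStoll2004, §5] -/
theorem sha_ne_zero_and_not_mem_zmultiples_of_selmer_of_inf_ker_eq_bot (p : ℕ) [Fact p.Prime]
    (hM : W.selmerGroup (p : ℤ) ⊓ (W.torsionH1ToH1 (p : ℤ)).ker = ⊥)
    {ξ₁ ξ₂ : W.galH1Torsion (p : ℤ)} (hξ₁ : ξ₁ ∈ W.selmerGroup (p : ℤ))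
    (hξ₂ : ξ₂ ∈ W.selmerGroup (p : ℤ)) {c₁ c₂ : W.sha}
    (hc₁ : (c₁ : W.galH1) = W.torsionH1ToH1 (p : ℤ) ξ₁)
    (hc₂ : (c₂ : W.galH1) = W.torsionH1ToH1 (p : ℤ) ξ₂)
    (hind0 : ∀ a b : ℤ, a • ξ₁ + b • ξ₂ = 0 → (p : ℤ) ∣ a ∧ (p : ℤ) ∣ b) :
    c₁ ≠ 0 ∧ c₂ ∉ AddSubgroup.zmultiples c₁ := by
  refine sha_ne_zero_and_not_mem_zmultiples_of_selmer W p hc₁ hc₂ fun a b h => hind0 a b ?_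
  have hmem : a • ξ₁ + b • ξ₂ ∈ W.selmerGroup (p : ℤ) ⊓ (W.torsionH1ToH1 (p : ℤ)).ker :=
    ⟨add_mem (AddSubgroup.zsmul_mem _ hξ₁ a) (AddSubgroup.zsmul_mem _ hξ₂ b),
      (AddMonoidHom.mem_ker).mpr h⟩
  rw [hM] at hmem
  exact (AddSubgroup.mem_bot).mp hmem

/-- **Rank-`1` transfer (the Mordell–Weil glue).** If the Mordell–Weil part of `Sel^(p)` lies on the
line `ℤ∙δ` (`selmerGroup_inf_ker_eq_zmultiples`: `δ = κ(P)` the located Mordell–Weil class), two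
Selmer elements `ξ₁, ξ₂` that are JOINTLY independent of `δ` (`a•ξ₁ + b•ξ₂ = m•δ ⇒ p ∣ a, b`, i.e.
`rank_𝔽ₚ {e₁, e₂, w} = 3` in a descent basis) have independent classes `c₁ ≠ 0`, `c₂ ∉ ℤ∙c₁` in
`Ш[p]`. Per-element admissibility (`eᵢ ∉ 𝔽ₚ∙w`) is NOT enough: `w = e₁ ± e₂` gives `c₁ = ∓c₂`.
[cite: SilvermanAEC2009, Thm X.4.2(a)] [cite: SchaeferStoll2004, §5] -/
theorem sha_ne_zero_and_not_mem_zmultiples_of_selmer_of_inf_ker_le_zmultiples (p : ℕ)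
    [Fact p.Prime] {δ : W.galH1Torsion (p : ℤ)}
    (hM : W.selmerGroup (p : ℤ) ⊓ (W.torsionH1ToH1 (p : ℤ)).ker ≤ AddSubgroup.zmultiples δ)
    {ξ₁ ξ₂ : W.galH1Torsion (p : ℤ)} (hξ₁ : ξ₁ ∈ W.selmerGroup (p : ℤ))
    (hξ₂ : ξ₂ ∈ W.selmerGroup (p : ℤ)) {c₁ c₂ : W.sha}
    (hc₁ : (c₁ : W.galH1) = W.torsionH1ToH1 (p : ℤ) ξ₁)
    (hc₂ : (c₂ : W.galH1) = W.torsionH1ToH1 (p : ℤ) ξ₂)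
    (hind3 : ∀ a b m : ℤ, a • ξ₁ + b • ξ₂ = m • δ → (p : ℤ) ∣ a ∧ (p : ℤ) ∣ b) :
    c₁ ≠ 0 ∧ c₂ ∉ AddSubgroup.zmultiples c₁ := by
  refine sha_ne_zero_and_not_mem_zmultiples_of_selmer W p hc₁ hc₂ fun a b h => ?_
  have hmem : a • ξ₁ + b • ξ₂ ∈ W.selmerGroup (p : ℤ) ⊓ (W.torsionH1ToH1 (p : ℤ)).ker :=
    ⟨add_mem (AddSubgroup.zsmul_mem _ hξ₁ a) (AddSubgroup.zsmul_mem _ hξ₂ b),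
      (AddMonoidHom.mem_ker).mpr h⟩
  obtain ⟨m, hm⟩ := AddSubgroup.mem_zmultiples_iff.mp (hM hmem)
  exact hind3 a b m hm.symm

end NumberField

/-! ### §2 Over `ℚ`, analytic rank `≤ 1`: the Mordell–Weil part from GZK, and the typed lower
halves with Selmer-level binders -/

section OverQ

variable (W : WeierstrassCurve ℚ) [W.IsElliptic] (p : ℕ) [hp : Fact p.Prime]

/-- **Analytic rank `0`, `#E(ℚ)[p] = 1` ⇒ `Sel^(p)(E/ℚ) ⊓ ker(H¹(ℚ,E[p]) → H¹(ℚ,E)) = ⊥`**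
(GZK `hGZK`: `rank E(ℚ) = r_an = 0`): the Selmer group maps injectively to `Ш[p]`, so NO
Mordell–Weil datum enters a rank-`0` second-descent record. [cite: SilvermanAEC2009, Thm X.4.2(a)] -/
theorem selmerGroup_inf_ker_eq_bot_of_analyticRank_eq_zero
    (hGZK : rank_eq_analyticRank_of_analyticRank_le_one) (hr : W.analyticRank = 0)
    (htors : Nat.card (AddSubgroup.torsionBy W.toAffine.Point (p : ℤ)) = 1) :
    W.selmerGroup (p : ℤ) ⊓ (W.torsionH1ToH1 (p : ℤ)).ker = ⊥ := by
  -- transport the computable `DecidableEq ℚ` of the binder to the classical one of the general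
  -- number-field theorem (as in `Typed/HigherDescentSelmerCertificate.lean`)
  have hinst : (instDecidableEqRat : DecidableEq ℚ) = fun a b => Classical.propDecidable (a = b) :=
    Subsingleton.elim _ _
  rw [hinst] at htors
  haveI : NeZero p := ⟨hp.out.ne_zero⟩
  have hrank : W.mordellWeilRank = 0 := (hGZK W (by omega)).1.trans hr
  exact selmerGroup_inf_ker_eq_bot W p hrank htors

/-- **Analytic rank `1`, `#E(ℚ)[p] = 1`, `δ ∈ Sel^(p)` a NON-ZERO class dying in `H¹(ℚ,E)` ⇒ the
Mordell–Weil part of `Sel^(p)(E/ℚ)` is `ℤ∙δ`** (GZK `hGZK`: `rank E(ℚ) = 1`; `δ = κ(P)` for the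
front's located generator `P ∉ pE(ℚ)` — any one will do). The Mordell–Weil glue of a rank-`1`
`NONEMPTY` record, kernel side. [cite: SilvermanAEC2009, Thm X.4.2(a) and VIII.6] -/
theorem selmerGroup_inf_ker_le_zmultiples_of_analyticRank_eq_one
    (hGZK : rank_eq_analyticRank_of_analyticRank_le_one) (hr : W.analyticRank = 1)
    (htors : Nat.card (AddSubgroup.torsionBy W.toAffine.Point (p : ℤ)) = 1)
    {δ : W.galH1Torsion (p : ℤ)} (hδ : δ ∈ W.selmerGroup (p : ℤ))
    (hδker : W.torsionH1ToH1 (p : ℤ) δ = 0) (hδ0 : δ ≠ 0) :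
    W.selmerGroup (p : ℤ) ⊓ (W.torsionH1ToH1 (p : ℤ)).ker ≤ AddSubgroup.zmultiples δ := by
  have hinst : (instDecidableEqRat : DecidableEq ℚ) = fun a b => Classical.propDecidable (a = b) :=
    Subsingleton.elim _ _
  rw [hinst] at htors
  have hrank : W.mordellWeilRank = 1 := (hGZK W (by omega)).1.trans hr
  exact (selmerGroup_inf_ker_eq_zmultiples W p hrank htors hδ hδker hδ0).le

/-- **The typed LOWER half at `p` from TWO `NONEMPTY` witnesses, SELMER-LEVEL binders, analytic
rank `0`** (class-free; `hcard`-free): GZK; Cassels–Tate (`hCT`); `#E(ℚ)[p] = 1`; two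
`𝔽_p`-independent Selmer elements `ξ₁, ξ₂ ∈ Sel^(p)(E/ℚ)` (`hind0`) with classes `c₁, c₂`
(`hc₁ hc₂`) that are `p`-th multiples in `Ш` (`hd₁ hd₂`: the two `NONEMPTY(witness)` verdicts);
`ord_p #Ш_an ≤ 4` ⇒ `MissingLowerBoundAt W p` (via `missingLowerBoundAt_of_casselsTate_of_two_divisible'`).
Per pair; nothing booked. [cite: SilvermanAEC2009, Thm. X.4.2(a) and Thm. X.4.14] [cite: Creutz2014, §1] -/
theorem missingLowerBoundAt_of_casselsTate_of_two_nonempty_selmer_rankZero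
    (hCT : exists_casselsTate_pairing (K := ℚ))
    (hGZK : rank_eq_analyticRank_of_analyticRank_le_one) (hr : W.analyticRank = 0)
    (htors : Nat.card (AddSubgroup.torsionBy W.toAffine.Point (p : ℤ)) = 1)
    {ξ₁ ξ₂ : W.galH1Torsion (p : ℤ)} (hξ₁ : ξ₁ ∈ W.selmerGroup (p : ℤ))
    (hξ₂ : ξ₂ ∈ W.selmerGroup (p : ℤ))
    (hind0 : ∀ a b : ℤ, a • ξ₁ + b • ξ₂ = 0 → (p : ℤ) ∣ a ∧ (p : ℤ) ∣ b)
    {c₁ c₂ d₁ d₂ : W.sha} (hc₁ : (c₁ : W.galH1) = W.torsionH1ToH1 (p : ℤ) ξ₁)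
    (hc₂ : (c₂ : W.galH1) = W.torsionH1ToH1 (p : ℤ) ξ₂) (hd₁ : p • d₁ = c₁) (hd₂ : p • d₂ = c₂)
    {q : ℚ} (hq : shaAn W = (q : ℂ)) (hv : padicValRat p q ≤ 4) : MissingLowerBoundAt W p := by
  obtain ⟨hc₁0, hind⟩ := sha_ne_zero_and_not_mem_zmultiples_of_selmer_of_inf_ker_eq_bot W p
    (selmerGroup_inf_ker_eq_bot_of_analyticRank_eq_zero W p hGZK hr htors) hξ₁ hξ₂ hc₁ hc₂ hind0
  exact missingLowerBoundAt_of_casselsTate_of_two_divisible' W p hCT hGZK (by omega)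
    (nsmul_eq_zero_of_coe_eq_torsionH1ToH1 W hp.out.ne_zero hξ₁ hc₁)
    (nsmul_eq_zero_of_coe_eq_torsionH1ToH1 W hp.out.ne_zero hξ₂ hc₂) hc₁0 hind hd₁ hd₂ hq hv

/-- **The typed LOWER half at `p` from ONE `NONEMPTY` witness + an independent Selmer partner,
SELMER-LEVEL binders, analytic rank `0`** (class-free): as above with only `ξ₁`'s class a `p`-th
multiple (`hd`); `ξ₂` is any second basis element (no verdict on it) ⇒ `p³ ∣ #Ш` ⇒
`MissingLowerBoundAt W p` for `ord_p #Ш_an ≤ 4` (`missingLowerBoundAt_of_casselsTate_of_one_divisible`).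
Per pair; nothing booked. [cite: SilvermanAEC2009, Thm. X.4.2(a) and Thm. X.4.14] [cite: Creutz2014, §1] -/
theorem missingLowerBoundAt_of_casselsTate_of_one_nonempty_selmer_rankZero
    (hCT : exists_casselsTate_pairing (K := ℚ))
    (hGZK : rank_eq_analyticRank_of_analyticRank_le_one) (hr : W.analyticRank = 0)
    (htors : Nat.card (AddSubgroup.torsionBy W.toAffine.Point (p : ℤ)) = 1)
    {ξ₁ ξ₂ : W.galH1Torsion (p : ℤ)} (hξ₁ : ξ₁ ∈ W.selmerGroup (p : ℤ))
    (hξ₂ : ξ₂ ∈ W.selmerGroup (p : ℤ))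
    (hind0 : ∀ a b : ℤ, a • ξ₁ + b • ξ₂ = 0 → (p : ℤ) ∣ a ∧ (p : ℤ) ∣ b)
    {c₁ c₂ d : W.sha} (hc₁ : (c₁ : W.galH1) = W.torsionH1ToH1 (p : ℤ) ξ₁)
    (hc₂ : (c₂ : W.galH1) = W.torsionH1ToH1 (p : ℤ) ξ₂) (hd : p • d = c₁)
    {q : ℚ} (hq : shaAn W = (q : ℂ)) (hv : padicValRat p q ≤ 4) : MissingLowerBoundAt W p := by
  obtain ⟨hc₁0, hind⟩ := sha_ne_zero_and_not_mem_zmultiples_of_selmer_of_inf_ker_eq_bot W p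
    (selmerGroup_inf_ker_eq_bot_of_analyticRank_eq_zero W p hGZK hr htors) hξ₁ hξ₂ hc₁ hc₂ hind0
  exact missingLowerBoundAt_of_casselsTate_of_one_divisible W p hCT hGZK (by omega)
    (nsmul_eq_zero_of_coe_eq_torsionH1ToH1 W hp.out.ne_zero hξ₁ hc₁)
    (nsmul_eq_zero_of_coe_eq_torsionH1ToH1 W hp.out.ne_zero hξ₂ hc₂) hc₁0 hind hd hq hv

/-- **The typed LOWER half at `p` from TWO `NONEMPTY` witnesses, SELMER-LEVEL binders, with the
Mordell–Weil line** (class-free; analytic rank `≤ 1`): GZK; Cassels–Tate; the Mordell–Weil part of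
`Sel^(p)` inside `ℤ∙δ` (`hM`, from `selmerGroup_inf_ker_le_zmultiples_of_analyticRank_eq_one` at
`r_an = 1`, trivially at `r_an = 0`); `ξ₁, ξ₂ ∈ Sel^(p)` JOINTLY independent of `δ` (`hind3`); both
classes `p`-th multiples; `ord_p #Ш_an ≤ 4` ⇒ `MissingLowerBoundAt W p`. Per pair; nothing booked.
[cite: SilvermanAEC2009, Thm. X.4.2(a) and Thm. X.4.14] [cite: Creutz2014, §1] -/
theorem missingLowerBoundAt_of_casselsTate_of_two_nonempty_selmer_mwLine
    (hCT : exists_casselsTate_pairing (K := ℚ))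
    (hGZK : rank_eq_analyticRank_of_analyticRank_le_one) (hr : W.analyticRank ≤ 1)
    {δ ξ₁ ξ₂ : W.galH1Torsion (p : ℤ)}
    (hM : W.selmerGroup (p : ℤ) ⊓ (W.torsionH1ToH1 (p : ℤ)).ker ≤ AddSubgroup.zmultiples δ)
    (hξ₁ : ξ₁ ∈ W.selmerGroup (p : ℤ)) (hξ₂ : ξ₂ ∈ W.selmerGroup (p : ℤ))
    (hind3 : ∀ a b m : ℤ, a • ξ₁ + b • ξ₂ = m • δ → (p : ℤ) ∣ a ∧ (p : ℤ) ∣ b)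
    {c₁ c₂ d₁ d₂ : W.sha} (hc₁ : (c₁ : W.galH1) = W.torsionH1ToH1 (p : ℤ) ξ₁)
    (hc₂ : (c₂ : W.galH1) = W.torsionH1ToH1 (p : ℤ) ξ₂) (hd₁ : p • d₁ = c₁) (hd₂ : p • d₂ = c₂)
    {q : ℚ} (hq : shaAn W = (q : ℂ)) (hv : padicValRat p q ≤ 4) : MissingLowerBoundAt W p := by
  obtain ⟨hc₁0, hind⟩ :=
    sha_ne_zero_and_not_mem_zmultiples_of_selmer_of_inf_ker_le_zmultiples W p hM hξ₁ hξ₂ hc₁ hc₂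
      hind3
  exact missingLowerBoundAt_of_casselsTate_of_two_divisible' W p hCT hGZK hr
    (nsmul_eq_zero_of_coe_eq_torsionH1ToH1 W hp.out.ne_zero hξ₁ hc₁)
    (nsmul_eq_zero_of_coe_eq_torsionH1ToH1 W hp.out.ne_zero hξ₂ hc₂) hc₁0 hind hd₁ hd₂ hq hv

omit hp in
/-- **X8 ∩ {r_an = 0} ∩ {surj(3)}, `ord₃ #Ш_an ≤ 4`: `BSD(E,3)` from PUBLISHED theorems + TWO
second-`3`-descent `NONEMPTY` witnesses on two members `ξ₁, ξ₂` of an `𝔽₃`-basis of `Sel^(3)(E/ℚ)`**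
— the SELMER-LEVEL form of `X8.bsdp_three_rankZero_of_casselsTate_of_two_nonempty_of_surj'`
(GEN 11, `hcard`-free): `surj(3)` ⇒ `E[3]` irreducible ⇒ `E(ℚ)[3] = 0`
(`natCard_torsionBy_eq_one_of_hasIrreducibleModPGaloisRep`), so at analytic rank `0` the Selmer
group injects into `Ш[3]` and the independence datum is `hind0` alone. Pattern for the X7 / X6 /
Prop-4.8 / X4-Kato twins (one-line substitutions of the `Ш`-level consumer). EVIDENCE pointers:
the `B1-ASK-SHA81` X8 rows (targets; nothing booked). Per pair; class X8 unchanged.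
[cite: Wuthrich2014, Prop. 21 (p. 400)] [cite: SilvermanAEC2009, Thm. X.4.2(a) and Thm. X.4.14]
[cite: Creutz2014, §1] [cite: Mazur1977, Ch. III §5, p. 157] [cite: Miller2011LMS, §1 and Def. 1.1] -/
theorem X8.bsdp_three_rankZero_of_casselsTate_of_two_nonempty_selmer_of_surj
    (hCT : exists_casselsTate_pairing (K := ℚ)) (hW : sha_dvd_analyticSha)
    (hGZK : rank_eq_analyticRank_of_analyticRank_le_one) (hmod : hasEntireLFunction_rat)
    (W : WeierstrassCurve ℚ) [W.IsElliptic] [W.IsGloballyMinimal] (hX : ClassX8 W 3) (hs : Surj W 3)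
    (hr : W.analyticRank = 0)
    {ξ₁ ξ₂ : W.galH1Torsion (3 : ℤ)} (hξ₁ : ξ₁ ∈ W.selmerGroup (3 : ℤ))
    (hξ₂ : ξ₂ ∈ W.selmerGroup (3 : ℤ))
    (hind0 : ∀ a b : ℤ, a • ξ₁ + b • ξ₂ = 0 → (3 : ℤ) ∣ a ∧ (3 : ℤ) ∣ b)
    {c₁ c₂ d₁ d₂ : W.sha} (hc₁ : (c₁ : W.galH1) = W.torsionH1ToH1 (3 : ℤ) ξ₁)
    (hc₂ : (c₂ : W.galH1) = W.torsionH1ToH1 (3 : ℤ) ξ₂) (hd₁ : 3 • d₁ = c₁) (hd₂ : 3 • d₂ = c₂)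
    {q : ℚ} (hq : shaAn W = (q : ℂ)) (hv : padicValRat 3 q ≤ 4) : BSDp W 3 := by
  haveI : Fact (Nat.Prime 3) := ⟨Nat.prime_three⟩
  have htors : Nat.card (AddSubgroup.torsionBy W.toAffine.Point ((3 : ℕ) : ℤ)) = 1 :=
    natCard_torsionBy_eq_one_of_hasIrreducibleModPGaloisRep W 3
      (hasIrreducibleModPGaloisRep_of_hasSurjectiveModNGaloisRep W 3 hs)
  exact X8.bsdp_of_missingLowerBoundAt_of_surj W 3 hW hGZK hmod hX hs hr
    (missingLowerBoundAt_of_casselsTate_of_two_nonempty_selmer_rankZero W 3 hCT hGZK hr htors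
      hξ₁ hξ₂ (by exact_mod_cast hind0) hc₁ hc₂ hd₁ hd₂ hq hv)

end OverQ

end Summit.BirchSwinnertonDyer.Rank1Residual.SecondDescent

end
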